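/-
Copyright (c) 2026 the pub-hodgecm-mathlib formalisation cell (harness21).  Prover seat hodgecm-mathlib-LH4-p13 (g8), req620 Track A «(D-RAM) FOUR-FRAME» squad, tier 0,
STAGE-1b (heir dealer LH4-plan (g13) D-1b §3∕§4, WORD #53∕#58: (L-lab) lane = the (α′) producer; chair LH4-r01 (g8) BOX MN (4)): brick (L-lab-15) «(α′) AT THE ★ DEFS
№5∕№6 LETTERS — THE PAYER OF `stub_law_labelClean`»: the fence arithmetic `mcOfRecord d ≤ n0CleanOfRecord d + d % 2 ↔ d ≤ 3`, the ED. 6 Prop `LabelPlusCleanLawAt N₀ mcOfRecord`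
under the fence, at `n0DerivedOfRecord` (every `d`) and at `n0CleanOfRecord` (`d ≤ 3`), and its `DyadicFence` closure = the tier-0 ED. 6 letter `stub_law_labelClean` BY TYPE.  2026-09-04.
-/
import Summits.HodgeConjecture.HodgeConjecture.Theorems.F0P3cDyRamModelSquareLevelClean   -- ★ p859653 (this seat, (L-lab-14)): `latticeInLevel_sq_of_shell_of_labelPlus_ofRecord`
import Summits.HodgeConjecture.HodgeConjecture.Theorems.F0P3cDyRamStageOneBDerivedDefs   -- ★ p859675 DEFS LEAF №6 (LH4-p05 (g8)): `LabelPlusCleanLawAt`, `n0DerivedOfRecord`, `mcOfRecord_le_n0DerivedOfRecord_add`;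
                                                                                            -- brings ★ p859562 №5 `mcOfRecord`, `n0CleanOfRecord`, ★ №1 `DyadicFence`, `dyadicFence_of`
import HarnessLib

/-!
# Crux `H413`, line LH4 «(D-RAM) FOUR-FRAME», STAGE-1b — (L-lab-15) «(α′) AT THE RECORD LETTERS: `LabelPlusCleanLawAt` PROVED; the payer of `stub_law_labelClean`»

Cell `hodgecm-mathlib` (D-0151), FLOOR 0, crux item H413 = `stmt-HodgeConjecture-24833`, route of record `HCCMUnconditional`; squad F0∕P3c∕LH4.  THEOREMS ONLY (no `def`, no
instance, no notation, no `sorry`, default heartbeats), ★-only imports, lane `--supports stmt-HodgeConjecture-24833`.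

* `mcOfRecord_le_n0CleanOfRecord_add_mod_two_iff` — the FENCE of ★ p859653 at the ★ p859562 letters: `mcOfRecord d ≤ n0CleanOfRecord d + d % 2 ↔ d ≤ 3` (`d = 1, 2, 3`:
  `2 ≤ 4`, `4 ≤ 4`, `8 ≤ 8`; `d = 4`: `10 ≰ 8`), by `omega` on the unfolded schedules; `mcOfRecord_eq` — `mcOfRecord d = mstarOfRecord d + d − 1` for `1 ≤ d`.
* **`labelPlusCleanLawAt_of_fence`** — ★ №6's Prop `LabelPlusCleanLawAt N₀ mcOfRecord σ ϖ d t` for EVERY threshold schedule `N₀` with `mcOfRecord d ≤ N₀ d + d % 2` (its body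
  is ★ p859653 `latticeInLevel_sq_of_shell_of_labelPlus_ofRecord` binder for binder, LH4-r01 (g8) BOX MD probe (iii)); hence **`labelPlusCleanLawAt_derived_ofRecord`**:
  `LabelPlusCleanLawAt n0DerivedOfRecord mcOfRecord σ ϖ d t` for every `d` (★ №6 `mcOfRecord_le_n0DerivedOfRecord_add`), **`labelPlusCleanLawAt_clean_ofRecord`**:
  `LabelPlusCleanLawAt n0CleanOfRecord mcOfRecord σ ϖ d t` for `d ≤ 3` (all datum classes of record: tame, R-U, R-P), and the unfolded `d ≤ 3` instance
  `latticeInLevel_mcOfRecord_of_shell_of_labelPlus`.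
* **`dyadicFence_labelPlusCleanLawAt_derived_ofRecord`** — `∀ σ ϖ d t, DyadicFence (LabelPlusCleanLawAt n0DerivedOfRecord mcOfRecord σ ϖ d t)`: the TYPE of the tier-0 ED. 6 letter
  `stub_law_labelClean` (dealer LH4-plan (g13) dry v2 2eb8808d :541, chair LH4-r01 (g8) BOX MN (4) probe d8d529c1) — the pen pays `stub_law_labelClean := <this name>`.

HONEST LABEL: count-neutral; (α′) is PROVED (at `n0DerivedOfRecord` for every `d`, at `n0CleanOfRecord` for `d ≤ 3`) — one ED. 6 letter fewer, no tier-0 row closed by itself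
((β) `stub_law_cleanSgn` is LH4-p05 (g8)'s; the derived T₊ row needs all four law letters + the H side); tier-0 rows T₊∕T₋∕regular OPEN.  HC_CM remains
proved only modulo the printed citations (2 remaining named inputs: hLiu418 = `stmt-HodgeConjecture-24832`, h413 = `stmt-HodgeConjecture-24833`) until rung 0 closes.
-/

noncomputable section

namespace Summit.HodgeConjecture.HodgeConjecture.Cruxes.H413.F0P3cDyRamLabelPlusCleanOfRecord

open Literature.NumberTheory.Automorphic Literature.NumberTheory.Automorphic.HermitianLattice Literature.NumberTheory.Automorphic.UnitaryGroup
open Literature.NumberTheory.Automorphic.UnitaryLatticeTree Literature.NumberTheory.Automorphic.UnitaryThreeFourFrame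
open Summit.HodgeConjecture.HodgeConjecture.Cruxes.H413.F0P3cDyRamFourFramePieces
open Summit.HodgeConjecture.HodgeConjecture.Cruxes.H413.F0P3cDyRamFourFrameCensusDefs
open Summit.HodgeConjecture.HodgeConjecture.Cruxes.H413.F0P3cDyRamFourFrameLawDefs (DyadicFence dyadicFence_of)
open Summit.HodgeConjecture.HodgeConjecture.Cruxes.H413.F0P3cDyRamStageOneBDefs (mcOfRecord n0CleanOfRecord)
open Summit.HodgeConjecture.HodgeConjecture.Cruxes.H413.F0P3cDyRamStageOneBDerivedDefs (n0DerivedOfRecord LabelPlusCleanLawAt mcOfRecord_le_n0DerivedOfRecord_add)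
open Summit.HodgeConjecture.HodgeConjecture.Cruxes.H413.F0P3cDyRamModelSquareLevelClean (latticeInLevel_sq_of_shell_of_labelPlus_ofRecord)
open scoped Valued WithZero Matrix MatrixGroups

/-- `mcOfRecord d = m* + d − 1` for `1 ≤ d` (`m* + d = d % 2 + 3d − 1` is odd). [cite: Rogawski1990, §4.9 Prop. 4.9.1 (b) p. 55] -/
theorem mcOfRecord_eq {d : ℕ} (hd : 1 ≤ d) : mcOfRecord d = mstarOfRecord d + d - 1 := by
  unfold mcOfRecord mstarOfRecord
  omega

/-- **THE FENCE OF RECORD**: `mcOfRecord d ≤ n0CleanOfRecord d + d % 2 ↔ d ≤ 3` — ★ p859653's hypothesis `m_c ≤ N₀ + ℓ₀` at the ★ p859562 letters holds exactly for the three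
datum classes of record (tame `d = 1`, R-U `d = 2`, R-P `d = 3`). [cite: Rogawski1990, §4.9 Prop. 4.9.1 (b) p. 55] -/
theorem mcOfRecord_le_n0CleanOfRecord_add_mod_two_iff (d : ℕ) : mcOfRecord d ≤ n0CleanOfRecord d + d % 2 ↔ d ≤ 3 := by
  unfold n0CleanOfRecord mcOfRecord mstarOfRecord
  omega

variable {K : Type} [Field K] [Valued K ℤᵐ⁰]

/-- **(α′) AT THE RECORD LETTERS, `d ≤ 3`.**  Ramified quadratic datum with `d ≤ 3`, a four-frame family, an element datum at the clean threshold `n0CleanOfRecord d`, the frame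
elements `Γ_b(α, β)`; at every `Γ_b`-fixed type-0 vertex `M` in the near-transvection shell `(d % 2, m*)` carrying `LatticeLabelPlus` at `m*`:
`(Γ_b − 1)·(Γ_b − 1)·M ⊆ ϖ^{mcOfRecord d}·M` (★ p859653 `latticeInLevel_sq_of_shell_of_labelPlus_ofRecord` at `N₀ = n0CleanOfRecord`, fence by the previous lemma).
[cite: Rogawski1990, §4.9 Prop. 4.9.1 (b) p. 55] [cite: Kottwitz1986BaseChangeUnits, §1 pp. 240–241] [cite: Jacobowitz1962, §4, §7] -/
theorem latticeInLevel_mcOfRecord_of_shell_of_labelPlus {σ : K →+* K} {ϖ : K} {d t : ℕ} (hd : d ≤ 3) (hD : IsRamifiedQuadraticDatum σ ϖ d t)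
    {f : Fin 4 → Fin 3 → (Fin 3 → K)} (hf : IsFourFrameFamily σ f) {α β : K} {n₁ n₂ n₃ : ℕ} (hE : IsElementDatum σ ϖ (n0CleanOfRecord d) α β n₁ n₂ n₃)
    {Γ : Fin 4 → GL (Fin 3) K} (hΓ : ∀ b, (Γ b : Matrix (Fin 3) (Fin 3) K) = frameElt σ f b α β) (b : Fin 4)
    {M : Submodule 𝒪[K] (Fin 3 → K)} (hM : IsVertexLattice σ ϖ ((StdForm.antidiagonal 3).over K) 0 M) (hfix : mapGL (Γ b) M = M)
    (hshell : LatticeNearTransvShell ϖ (d % 2) (mstarOfRecord d) ((Γ b : Matrix (Fin 3) (Fin 3) K) - 1) M)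
    (hlab : LatticeLabelPlus σ ϖ d (mstarOfRecord d) M ((Γ b : Matrix (Fin 3) (Fin 3) K) - 1)) :
    LatticeInLevel ϖ (mcOfRecord d) (((Γ b : Matrix (Fin 3) (Fin 3) K) - 1) * ((Γ b : Matrix (Fin 3) (Fin 3) K) - 1)) M :=
  latticeInLevel_sq_of_shell_of_labelPlus_ofRecord hD n0CleanOfRecord ((mcOfRecord_le_n0CleanOfRecord_add_mod_two_iff d).2 hd) hf hE hΓ b hM hfix hshell hlab

/-! ## §2  The ED. 6 Prop `LabelPlusCleanLawAt` under the fence; the payer of `stub_law_labelClean` -/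

/-- **(α′) AS THE ★ №6 PROP, ANY THRESHOLD ABOVE THE FENCE**: `mcOfRecord d ≤ N₀ d + d % 2 → LabelPlusCleanLawAt N₀ mcOfRecord σ ϖ d t` — ★ p859653
`latticeInLevel_sq_of_shell_of_labelPlus_ofRecord`, whose statement is the Prop's body binder for binder (`mcOfRecord d` unfolds to `2·((m* + d)∕2)`).
[cite: Rogawski1990, §4.9 Prop. 4.9.1 (b) p. 55] [cite: Kottwitz1986BaseChangeUnits, §1 pp. 240–241] -/
theorem labelPlusCleanLawAt_of_fence [CompleteSpace K] [Fintype (Valued.ResidueField K)] (N₀ : ℕ → ℕ) (σ : K →+* K) (ϖ : K) {d : ℕ} (t : ℕ)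
    (hN : mcOfRecord d ≤ N₀ d + d % 2) : LabelPlusCleanLawAt N₀ mcOfRecord σ ϖ d t :=
  fun hD _f hf _α _β _n₁ _n₂ _n₃ hE _Γ hΓ b _M hM hfix hshell hlab => latticeInLevel_sq_of_shell_of_labelPlus_ofRecord hD N₀ hN hf hE hΓ b hM hfix hshell hlab

/-- **(α′) AT THE DERIVED THRESHOLD, EVERY `d`**: `LabelPlusCleanLawAt n0DerivedOfRecord mcOfRecord σ ϖ d t` (fence by ★ №6 `mcOfRecord_le_n0DerivedOfRecord_add`).
[cite: Rogawski1990, §4.9 Prop. 4.9.1 (b) p. 55] [cite: Kottwitz1986BaseChangeUnits, §1 pp. 240–241] -/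
theorem labelPlusCleanLawAt_derived_ofRecord [CompleteSpace K] [Fintype (Valued.ResidueField K)] (σ : K →+* K) (ϖ : K) (d t : ℕ) :
    LabelPlusCleanLawAt n0DerivedOfRecord mcOfRecord σ ϖ d t :=
  labelPlusCleanLawAt_of_fence n0DerivedOfRecord σ ϖ t (mcOfRecord_le_n0DerivedOfRecord_add d)

/-- **(α′) AT THE CLEAN THRESHOLD, `d ≤ 3`**: `LabelPlusCleanLawAt n0CleanOfRecord mcOfRecord σ ϖ d t` for the three datum classes of record (fence by §1).
[cite: Rogawski1990, §4.9 Prop. 4.9.1 (b) p. 55] [cite: Kottwitz1986BaseChangeUnits, §1 pp. 240–241] -/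
theorem labelPlusCleanLawAt_clean_ofRecord [CompleteSpace K] [Fintype (Valued.ResidueField K)] (σ : K →+* K) (ϖ : K) {d : ℕ} (t : ℕ) (hd : d ≤ 3) :
    LabelPlusCleanLawAt n0CleanOfRecord mcOfRecord σ ϖ d t :=
  labelPlusCleanLawAt_of_fence n0CleanOfRecord σ ϖ t ((mcOfRecord_le_n0CleanOfRecord_add_mod_two_iff d).2 hd)

/-- **THE PAYER OF THE TIER-0 ED. 6 LETTER `stub_law_labelClean`, BY TYPE**: `∀ σ ϖ d t, DyadicFence (LabelPlusCleanLawAt n0DerivedOfRecord mcOfRecord σ ϖ d t)` (the fence `|2| < 1` is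
not even used: (α′) holds at every ramified quadratic datum). [cite: Rogawski1990, §4.9 Prop. 4.9.1 (b) p. 55] [cite: Kottwitz1986BaseChangeUnits, §1 pp. 240–241] -/
theorem dyadicFence_labelPlusCleanLawAt_derived_ofRecord :
    ∀ {K : Type} [Field K] [Valued K ℤᵐ⁰] [CompleteSpace K] [Fintype (Valued.ResidueField K)] (σ : K →+* K) (ϖ : K) (d t : ℕ),
      DyadicFence (K := K) (LabelPlusCleanLawAt n0DerivedOfRecord mcOfRecord σ ϖ d t) :=
  fun σ ϖ d t => dyadicFence_of (labelPlusCleanLawAt_derived_ofRecord σ ϖ d t)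

end Summit.HodgeConjecture.HodgeConjecture.Cruxes.H413.F0P3cDyRamLabelPlusCleanOfRecord

end
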